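import Literature.Analysis.Calculus.HardyExterior
import Mathlib.Analysis.Calculus.BumpFunction.InnerProduct
import Mathlib.Analysis.SpecialFunctions.JapaneseBracket
import HarnessLib

/-!
# Hardy's inequality in the exterior of a ball for functions defined only there and decaying at
# infinity: `∫_{‖y‖ > R} u²/‖y‖² ≤ (2/(n − 2))² ∫_{‖y‖ > R} ‖Du‖²`

(namespace `Literature.Analysis.Calculus`; sequel of `HardyExterior.lean`)

`HardyExterior.lean` proves the exterior Hardy inequality for `u ∈ C¹_c(E)`. The functions to
which it is applied along the hyperboloidal leaves of a black-hole exterior — a solution of the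
wave equation and its Cartesian derivatives, read on a leaf terminating at null infinity — are
neither compactly supported (the leaf reaches `𝓘⁺`, where the radiation field lives) nor defined on
the whole slice (only outside the horizon). What one has instead is smoothness outside a smaller
ball and decay, `|u| ≲ 1/r` (in dimension `3`), so that `u²/r²` is integrable at infinity; and the
conclusion wanted is the same inequality, with the same constant and no boundary term. This is how
Hardy inequalities are used on hyperboloids by Dafermos–Rodnianski–Shlapentokh-Rothman
(arXiv:1402.7034, §4.3: "for functions with the appropriate decay") and by Moschidis
(arXiv:1509.08489, Lemma 12.3 and the Hardy-type inequalities of §8–§9 on `{t̄ = τ}`, stated for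
functions with `r^{1/2} φ → 0`-type decay at infinity).

* `hardy_sq_lintegral_exterior_le_of_integrable` (**proved**): `E` a real inner product space of
  dimension `n ≥ 3`, `0 < R`, `u : E → ℝ` of class `C¹` at every point of `{‖y‖ > R₀}` for some
  `R₀ < R`, and `∫_{‖y‖ > R} u²/‖y‖² < ∞`. Then, as `ℝ≥0∞`-valued Lebesgue integrals,
  `∫_{‖y‖ > R} u²/‖y‖² ≤ (2/(n−2))² ∫_{‖y‖ > R} ‖Du‖²`.
* `lintegral_sq_div_norm_sq_lt_top_of_decay` (**proved**): in dimension `3`, the integrability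
  hypothesis follows from the decay `‖y‖ |u(y)| ≤ C₀` on `{‖y‖ > R}`.
* `hardy_sq_lintegral_exterior_le_of_decay` (**proved**): the combination, dimension `3`.

## Proof

Multiply `u` by an inner cut-off `χ_in` (`= 0` on a ball inside `{‖y‖ > R₀}`, `= 1` on
`{‖y‖ ≥ R}`) and by the scaled cut-offs `χ_k(y) = χ₁(y/k)` (`= 1` on `{‖y‖ ≤ k}`, `= 0` on
`{‖y‖ ≥ 2k}`, `‖Dχ_k‖ ≤ C₁/k ≤ 2C₁/‖y‖` on its transition shell): `u_k = χ_in χ_k u ∈ C¹_c(E)`, and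
on `{‖y‖ > R}` one has `u_k = χ_k u`, `‖Du_k‖² ≤ (1+ε)‖Du‖² + (1+ε⁻¹) 4C₁² (u²/‖y‖²) 1_{‖y‖ ≥ k}`.
The compactly supported inequality thus gives
`∫_{R<‖y‖≤k} u²/‖y‖² ≤ c(1+ε) ∫_{‖y‖>R} ‖Du‖² + c(1+ε⁻¹)4C₁² ∫_{‖y‖ ≥ k} u²/‖y‖²`, the last
integral being a tail of a finite integral; `k → ∞` (monotone convergence on the left, no
measurability of `u` off `{‖y‖ > R}` needed) and then `ε → 0`.

## References

* M. Dafermos, I. Rodnianski, Y. Shlapentokh-Rothman, arXiv:1402.7034 = Ann. of Math. 183 (2016),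
  §4.3 (key `DafermosRodnianskiShlapentokhrothman2014`).
* G. Moschidis, arXiv:1509.08489 = Ann. PDE 2 (2016), Lemma 12.3 (key `Moschidis2016`).
-/

noncomputable section

open MeasureTheory Set Filter Module Metric Topology
open scoped Topology ENNReal

namespace Literature.Analysis.Calculus

variable {E : Type*} [NormedAddCommGroup E] [InnerProductSpace ℝ E] [FiniteDimensional ℝ E]
  [MeasurableSpace E] [BorelSpace E]

/-! ### Elementary inequality -/

/-- `(a + b)² ≤ (1 + ε) a² + (1 + ε⁻¹) b²` for `ε > 0`. [folklore] -/
theorem add_sq_le_eps (a b : ℝ) {ε : ℝ} (hε : 0 < ε) :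
    (a + b) ^ 2 ≤ (1 + ε) * a ^ 2 + (1 + ε⁻¹) * b ^ 2 := by
  have hε' : ε ≠ 0 := hε.ne'
  have h1 : ε⁻¹ * (ε * a - b) ^ 2 = ε * a ^ 2 - 2 * a * b + ε⁻¹ * b ^ 2 := by
    field_simp
    ring
  have h2 : 0 ≤ ε⁻¹ * (ε * a - b) ^ 2 := mul_nonneg (inv_nonneg.mpr hε.le) (sq_nonneg _)
  nlinarith [h1, h2]

/-! ### Cut-off functions -/

omit [MeasurableSpace E] [BorelSpace E] in
/-- **Scaled cut-offs.** There are `C¹` functions `χ_k : E → [0, 1]` (`k > 0`) with `χ_k = 1` on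
`{‖y‖ ≤ k}`, `χ_k = 0` on `{‖y‖ ≥ 2k}`, `Dχ_k = 0` on `{‖y‖ < k}` and `‖Dχ_k(y)‖ ≤ 2C₁/‖y‖` on
`{‖y‖ ≥ k}`, for one constant `C₁` (scale a fixed bump function). [folklore] -/
theorem exists_scaled_cutoff :
    ∃ (χ : ℝ → E → ℝ) (C₁ : ℝ), 0 ≤ C₁ ∧ ∀ k : ℝ, 0 < k →
      ContDiff ℝ 1 (χ k) ∧ (∀ y, 0 ≤ χ k y) ∧ (∀ y, χ k y ≤ 1) ∧
      (∀ y : E, ‖y‖ ≤ k → χ k y = 1) ∧ (∀ y : E, 2 * k ≤ ‖y‖ → χ k y = 0) ∧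
      (∀ y : E, ‖y‖ < k → fderiv ℝ (χ k) y = 0) ∧
      (∀ y : E, k ≤ ‖y‖ → ‖fderiv ℝ (χ k) y‖ ≤ 2 * C₁ / ‖y‖) := by
  let b : ContDiffBump (0 : E) := ⟨1, 2, one_pos, one_lt_two⟩
  have hb1 : ContDiff ℝ 1 b := b.contDiff
  obtain ⟨C, hC⟩ := (hb1.continuous_fderiv one_ne_zero).bounded_above_of_compact_support
    (b.hasCompactSupport.fderiv (𝕜 := ℝ))
  refine ⟨fun k y ↦ b (k⁻¹ • y), max C 0, le_max_right _ _, fun k hk ↦ ?_⟩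
  have hkinv : 0 < k⁻¹ := inv_pos.mpr hk
  have hnorm : ∀ y : E, ‖k⁻¹ • y‖ = k⁻¹ * ‖y‖ := fun y ↦ by
    rw [norm_smul, Real.norm_eq_abs, abs_of_pos hkinv]
  have hsmooth : ContDiff ℝ 1 (fun y : E ↦ b (k⁻¹ • y)) := hb1.comp (contDiff_const_smul _)
  -- the derivative by the chain rule
  have hderiv : ∀ y : E, HasFDerivAt (fun y : E ↦ b (k⁻¹ • y))
      ((fderiv ℝ b (k⁻¹ • y)).comp (k⁻¹ • ContinuousLinearMap.id ℝ E)) y := by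
    intro y
    have h1 : HasFDerivAt (fun y : E ↦ k⁻¹ • y) (k⁻¹ • ContinuousLinearMap.id ℝ E) y :=
      (hasFDerivAt_id y).const_smul k⁻¹
    have h2 : HasFDerivAt b (fderiv ℝ b (k⁻¹ • y)) (k⁻¹ • y) :=
      ((hb1.differentiable one_ne_zero) _).hasFDerivAt
    exact h2.comp y h1
  -- vanishing of the derivative off the shell
  have hD0_in : ∀ y : E, ‖y‖ < k → fderiv ℝ (fun y : E ↦ b (k⁻¹ • y)) y = 0 := by
    intro y hy
    have hy' : k⁻¹ • y ∈ ball (0 : E) b.rIn := by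
      rw [mem_ball_zero_iff, hnorm]
      calc k⁻¹ * ‖y‖ < k⁻¹ * k := mul_lt_mul_of_pos_left hy hkinv
        _ = 1 := inv_mul_cancel₀ hk.ne'
    have hev : (fun y : E ↦ b (k⁻¹ • y)) =ᶠ[𝓝 y] fun _ ↦ (1 : ℝ) :=
      (b.eventuallyEq_one_of_mem_ball hy').comp_tendsto
        ((continuous_const_smul k⁻¹).tendsto y)
    rw [hev.fderiv_eq]
    exact (hasFDerivAt_const (𝕜 := ℝ) (1 : ℝ) y).fderiv
  have hD0_out : ∀ y : E, 2 * k < ‖y‖ → fderiv ℝ (fun y : E ↦ b (k⁻¹ • y)) y = 0 := by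
    intro y hy
    have hev : (fun y : E ↦ b (k⁻¹ • y)) =ᶠ[𝓝 y] fun _ ↦ (0 : ℝ) := by
      have hopen : IsOpen {z : E | 2 * k < ‖z‖} := isOpen_lt continuous_const continuous_norm
      filter_upwards [hopen.mem_nhds hy] with z hz
      refine b.zero_of_le_dist ?_
      rw [dist_zero_right, hnorm]
      calc (b.rOut : ℝ) = k⁻¹ * (2 * k) := by
            change (2 : ℝ) = k⁻¹ * (2 * k); field_simp
        _ ≤ k⁻¹ * ‖z‖ := mul_le_mul_of_nonneg_left (le_of_lt hz) hkinv.le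
    rw [hev.fderiv_eq]
    exact (hasFDerivAt_const (𝕜 := ℝ) (0 : ℝ) y).fderiv
  refine ⟨hsmooth, fun y ↦ b.nonneg' _, fun y ↦ b.le_one, fun y hy ↦ ?_, fun y hy ↦ ?_,
    hD0_in, fun y hy ↦ ?_⟩
  · -- `= 1` on the ball of radius `k`
    refine b.one_of_mem_closedBall ?_
    rw [mem_closedBall_zero_iff, hnorm]
    calc k⁻¹ * ‖y‖ ≤ k⁻¹ * k := mul_le_mul_of_nonneg_left hy hkinv.le
      _ = 1 := inv_mul_cancel₀ hk.ne'
  · -- `= 0` outside the ball of radius `2k`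
    refine b.zero_of_le_dist ?_
    rw [dist_zero_right, hnorm]
    calc (b.rOut : ℝ) = k⁻¹ * (2 * k) := by
          change (2 : ℝ) = k⁻¹ * (2 * k); field_simp
      _ ≤ k⁻¹ * ‖y‖ := mul_le_mul_of_nonneg_left hy hkinv.le
  · -- the derivative bound on `{‖y‖ ≥ k}`
    have hypos : 0 < ‖y‖ := hk.trans_le hy
    rcases le_or_gt ‖y‖ (2 * k) with hy2 | hy2
    · rw [(hderiv y).fderiv]
      calc ‖(fderiv ℝ b (k⁻¹ • y)).comp (k⁻¹ • ContinuousLinearMap.id ℝ E)‖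
          ≤ ‖fderiv ℝ b (k⁻¹ • y)‖ * ‖k⁻¹ • ContinuousLinearMap.id ℝ E‖ :=
            ContinuousLinearMap.opNorm_comp_le _ _
        _ ≤ max C 0 * (k⁻¹ * 1) := by
            refine mul_le_mul ((hC _).trans (le_max_left _ _)) ?_ (norm_nonneg _)
              (le_max_right _ _)
            rw [norm_smul, Real.norm_eq_abs, abs_of_pos hkinv]
            exact mul_le_mul_of_nonneg_left ContinuousLinearMap.norm_id_le hkinv.le
        _ = max C 0 / k := by ring
        _ ≤ 2 * max C 0 / ‖y‖ := by
            rw [div_le_div_iff₀ hk hypos]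
            nlinarith [le_max_right C 0]
    · rw [hD0_out y hy2, norm_zero]
      positivity

omit [FiniteDimensional ℝ E] [MeasurableSpace E] [BorelSpace E] in
/-- **Inner cut-off.** For `0 < R₁ < R` there is a `C¹` function `χ_in : E → [0, 1]` vanishing near
every point of the closed ball of radius `R₁` and equal to `1` on `{‖y‖ ≥ R}`. [folklore] -/
theorem exists_inner_cutoff {R₁ R : ℝ} (hR₁ : 0 < R₁) (hR₁R : R₁ < R) :
    ∃ χin : E → ℝ, ContDiff ℝ 1 χin ∧ (∀ y, R ≤ ‖y‖ → χin y = 1) ∧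
      (∀ y : E, ‖y‖ < R₁ → χin =ᶠ[𝓝 y] fun _ ↦ 0) ∧ (∀ y : E, ‖y‖ ≤ R₁ → χin y = 0) := by
  let b : ContDiffBump (0 : E) := ⟨R₁, R, hR₁, hR₁R⟩
  refine ⟨fun y ↦ 1 - b y, contDiff_const.sub b.contDiff, fun y hy ↦ ?_, fun y hy ↦ ?_,
    fun y hy ↦ ?_⟩
  · have : b y = 0 := b.zero_of_le_dist (by rwa [dist_zero_right])
    simp [this]
  · have hy' : y ∈ ball (0 : E) b.rIn := by rwa [mem_ball_zero_iff]
    filter_upwards [b.eventuallyEq_one_of_mem_ball hy'] with z hz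
    simp [hz]
  · have : b y = 1 := b.one_of_mem_closedBall (by rwa [mem_closedBall_zero_iff])
    simp [this]

/-! ### The inequality -/

/-- **Hardy's inequality outside a ball, for functions defined near the exterior with
`u²/‖y‖²` integrable** (the form needed on hyperboloidal leaves: Dafermos–Rodnianski–
Shlapentokh-Rothman, arXiv:1402.7034, §4.3; Moschidis, arXiv:1509.08489, Lemma 12.3). Let
`dim E = n ≥ 3`, `0 < R`, `R₀ < R`, let `u : E → ℝ` be `C¹` at every point of `{‖y‖ > R₀}`, and
assume `∫_{‖y‖ > R} u²/‖y‖² < ∞`. Then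
`∫_{‖y‖ > R} u²/‖y‖² ≤ (2/(n−2))² ∫_{‖y‖ > R} ‖Du‖²` (Lebesgue integrals in `ℝ≥0∞`; the right
side may be infinite). [cite: DafermosRodnianskiShlapentokhrothman2014, §4.3] -/
theorem hardy_sq_lintegral_exterior_le_of_integrable {u : E → ℝ} {R₀ R : ℝ} (hR₀ : R₀ < R)
    (hR : 0 < R) (hu : ∀ y : E, R₀ < ‖y‖ → ContDiffAt ℝ 1 u y)
    (hint : ∫⁻ y in {y : E | R < ‖y‖}, ENNReal.ofReal (u y ^ 2 / ‖y‖ ^ 2) < ⊤)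
    (hn : 3 ≤ finrank ℝ E) :
    ∫⁻ y in {y : E | R < ‖y‖}, ENNReal.ofReal (u y ^ 2 / ‖y‖ ^ 2) ≤
      ENNReal.ofReal ((2 / ((finrank ℝ E : ℝ) - 2)) ^ 2) *
        ∫⁻ y in {y : E | R < ‖y‖}, ENNReal.ofReal (‖fderiv ℝ u y‖ ^ 2) := by
  -- notation
  set S : Set E := {y | R < ‖y‖} with hSdef
  have hSo : IsOpen S := isOpen_lt continuous_const continuous_norm
  have hSm : MeasurableSet S := hSo.measurableSet
  set F : E → ℝ≥0∞ := fun y ↦ ENNReal.ofReal (u y ^ 2 / ‖y‖ ^ 2) with hFdef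
  set G : E → ℝ≥0∞ := fun y ↦ ENNReal.ofReal (‖fderiv ℝ u y‖ ^ 2) with hGdef
  set c : ℝ := (2 / ((finrank ℝ E : ℝ) - 2)) ^ 2 with hcdef
  have hn' : (2 : ℝ) < finrank ℝ E := by exact_mod_cast (show 2 < finrank ℝ E by omega)
  have hcpos : 0 < c := by rw [hcdef]; exact pow_pos (div_pos two_pos (by linarith)) 2
  set I : ℝ≥0∞ := ∫⁻ y in S, F y with hIdef
  set D : ℝ≥0∞ := ∫⁻ y in S, G y with hDdef
  have hItop : I ≠ ⊤ := hint.ne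
  -- `u` is `C¹` on the open set `U₀ = {‖y‖ > R₀} ⊇ S`; `G` is a.e.-measurable on `S`
  have hSU : ∀ y ∈ S, R₀ < ‖y‖ := fun y hy ↦ hR₀.trans hy
  have hGm : AEMeasurable G (volume.restrict S) := by
    have hcont : ContDiffOn ℝ 1 u S := fun y hy ↦ (hu y (hSU y hy)).contDiffWithinAt
    have hDc : ContinuousOn (fderiv ℝ u) S := hcont.continuousOn_fderiv_of_isOpen hSo le_rfl
    exact (ENNReal.continuous_ofReal.comp_continuousOn
      ((continuous_pow 2).comp_continuousOn hDc.norm)).aemeasurable hSm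
  -- the cut-offs
  set R₁ : ℝ := (max R₀ 0 + R) / 2 with hR₁def
  have hR₁pos : 0 < R₁ := by
    have : 0 ≤ max R₀ 0 := le_max_right _ _
    rw [hR₁def]; linarith
  have hR₁R : R₁ < R := by
    have : max R₀ 0 < R := max_lt hR₀ hR
    rw [hR₁def]; linarith
  have hR₀R₁ : R₀ < R₁ := by
    have h1 : R₀ ≤ max R₀ 0 := le_max_left _ _
    have h2 : max R₀ 0 < R := max_lt hR₀ hR
    rw [hR₁def]; linarith
  obtain ⟨χin, hχinC, hχin1, hχin0, hχin0'⟩ := exists_inner_cutoff (E := E) hR₁pos hR₁R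
  obtain ⟨χ, C₁, hC₁, hχ⟩ := exists_scaled_cutoff (E := E)
  -- the tail and the truncated integrals
  set m : ℕ → ℝ≥0∞ := fun k ↦ ∫⁻ y in S ∩ closedBall (0 : E) k, F y with hmdef
  set t : ℕ → ℝ≥0∞ := fun k ↦ ∫⁻ y in S ∩ {y : E | (k : ℝ) ≤ ‖y‖}, F y with htdef
  -- (B) the tail plus the truncation at `k - 1` is at most `I`
  have hB : ∀ k : ℕ, 1 ≤ k → t k + m (k - 1) ≤ I := by
    intro k hk
    have hsub : S ∩ {y : E | (k : ℝ) ≤ ‖y‖} ⊆ S \ closedBall (0 : E) ((k - 1 : ℕ) : ℝ) := by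
      intro y hy
      refine ⟨hy.1, fun hy' ↦ ?_⟩
      rw [mem_closedBall_zero_iff] at hy'
      have h1 : ((k - 1 : ℕ) : ℝ) = (k : ℝ) - 1 := by
        rw [Nat.cast_sub hk, Nat.cast_one]
      have h2 : (k : ℝ) ≤ ‖y‖ := hy.2
      linarith
    calc t k + m (k - 1) ≤ (∫⁻ y in S \ closedBall (0 : E) ((k - 1 : ℕ) : ℝ), F y) +
          ∫⁻ y in S ∩ closedBall (0 : E) ((k - 1 : ℕ) : ℝ), F y :=
          add_le_add (lintegral_mono_set hsub) le_rfl
      _ = I := by rw [add_comm, lintegral_inter_add_sdiff _ _ measurableSet_closedBall]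
  -- (C) the truncated integrals increase to `I`
  have hCm : Tendsto m atTop (𝓝 I) := by
    have hmono : Monotone m := by
      intro k l hkl
      exact lintegral_mono_set (inter_subset_inter_right _
        (closedBall_subset_closedBall (by exact_mod_cast hkl)))
    have hsup : ⨆ k, m k = I := by
      have hdir : Directed (· ⊆ ·) fun k : ℕ ↦ S ∩ closedBall (0 : E) k :=
        Monotone.directed_le fun k l hkl ↦ inter_subset_inter_right _
          (closedBall_subset_closedBall (by exact_mod_cast hkl))
      have hU : (⋃ k : ℕ, S ∩ closedBall (0 : E) k) = S := by
        ext y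
        simp only [mem_iUnion, mem_inter_iff, mem_closedBall_zero_iff]
        constructor
        · rintro ⟨k, hy, -⟩; exact hy
        · intro hy
          obtain ⟨k, hk⟩ := exists_nat_ge ‖y‖
          exact ⟨k, hy, hk⟩
      rw [hIdef, ← hU, setLIntegral_iUnion_of_directed _ hdir]
    rw [← hsup]
    exact tendsto_atTop_iSup hmono
  -- (A) the inequality for the truncations, from the compactly supported inequality for
  -- `u_k = χ_in χ_k u`
  have hA : ∀ (k : ℕ), 1 ≤ k → ∀ ε : ℝ, 0 < ε →
      m k ≤ ENNReal.ofReal (c * (1 + ε)) * D +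
        ENNReal.ofReal (c * (1 + ε⁻¹) * (4 * C₁ ^ 2)) * t k := by
    intro k hk ε hε
    have hkpos : (0 : ℝ) < k := by exact_mod_cast hk
    obtain ⟨hχC, hχnn, hχ1, hχone, hχzero, hχD0, hχD⟩ := hχ k hkpos
    -- the truncated function
    set v : E → ℝ := fun y ↦ χin y * (χ k y * u y) with hvdef
    have hvS : ∀ y ∈ S, v y = χ k y * u y := fun y hy ↦ by
      rw [hvdef]; simp [hχin1 y (le_of_lt hy)]
    -- `v ∈ C¹_c`
    have hvC : ContDiff ℝ 1 v := by
      rw [contDiff_iff_contDiffAt]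
      intro y
      by_cases hy : R₀ < ‖y‖
      · exact hχinC.contDiffAt.mul (hχC.contDiffAt.mul (hu y hy))
      · have hy' : ‖y‖ < R₁ := (not_lt.mp hy).trans_lt hR₀R₁
        have hev : v =ᶠ[𝓝 y] fun _ ↦ (0 : ℝ) := by
          filter_upwards [hχin0 y hy'] with z hz
          simp [hvdef, hz]
        exact contDiffAt_const.congr_of_eventuallyEq hev
    have hvc : HasCompactSupport v := by
      refine HasCompactSupport.intro (isCompact_closedBall (0 : E) (2 * k)) fun y hy ↦ ?_
      rw [mem_closedBall_zero_iff, not_le] at hy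
      simp [hvdef, hχzero y hy.le]
    -- the compactly supported Hardy inequality, in `ℝ≥0∞`
    have hH := hardy_sq_integral_exterior_le hvC hvc hR hn
    have hvcont : Continuous v := hvC.continuous
    have hDvcont : Continuous (fderiv ℝ v) := hvC.continuous_fderiv one_ne_zero
    have hv0 : ∀ y : E, ‖y‖ ≤ R₁ → v y = 0 := fun y hy ↦ by simp [hvdef, hχin0' y hy]
    have hFv_int : Integrable fun y ↦ v y ^ 2 / ‖y‖ ^ 2 := by
      have hvc2 : HasCompactSupport fun y ↦ v y ^ 2 :=
        hvc.comp_left (g := fun t : ℝ ↦ t ^ 2) (by simp)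
      have hg : Integrable fun y ↦ v y ^ 2 / R₁ ^ 2 :=
        ((hvcont.pow 2).integrable_of_hasCompactSupport hvc2).div_const _
      refine hg.mono' ((hvcont.measurable.pow_const 2).div
        (measurable_norm.pow_const 2)).aestronglyMeasurable (ae_of_all _ fun y ↦ ?_)
      rw [Real.norm_eq_abs, abs_of_nonneg (by positivity)]
      rcases le_or_gt ‖y‖ R₁ with hy | hy
      · simp [hv0 y hy]
      · exact div_le_div_of_nonneg_left (sq_nonneg _) (by positivity)
          (pow_le_pow_left₀ hR₁pos.le hy.le 2)
    have hDvc2 : HasCompactSupport fun y ↦ ‖fderiv ℝ v y‖ ^ 2 :=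
      (hvc.fderiv (𝕜 := ℝ)).comp_left (g := fun L : E →L[ℝ] ℝ ↦ ‖L‖ ^ 2) (by simp)
    have hGv_int : Integrable fun y ↦ ‖fderiv ℝ v y‖ ^ 2 :=
      ((continuous_norm.comp hDvcont).pow 2).integrable_of_hasCompactSupport hDvc2
    have hH' : (∫⁻ y in S, ENNReal.ofReal (v y ^ 2 / ‖y‖ ^ 2)) ≤
        ENNReal.ofReal c * ∫⁻ y in S, ENNReal.ofReal (‖fderiv ℝ v y‖ ^ 2) := by
      rw [← ofReal_integral_eq_lintegral_ofReal hFv_int.integrableOn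
          (ae_of_all _ fun y ↦ by positivity),
        ← ofReal_integral_eq_lintegral_ofReal hGv_int.integrableOn
          (ae_of_all _ fun y ↦ by positivity),
        ← ENNReal.ofReal_mul hcpos.le]
      exact ENNReal.ofReal_le_ofReal hH
    -- the pointwise bound for `‖Dv‖²` on `S`
    have hpt : ∀ y ∈ S, ENNReal.ofReal (‖fderiv ℝ v y‖ ^ 2) ≤
        ENNReal.ofReal (1 + ε) * G y +
          ENNReal.ofReal ((1 + ε⁻¹) * (4 * C₁ ^ 2)) *
            ({y : E | (k : ℝ) ≤ ‖y‖}.indicator F y) := by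
      intro y hy
      have hyR : R < ‖y‖ := hy
      have hypos : 0 < ‖y‖ := hR.trans hyR
      -- `Dv = D(χ_k u)` at `y`
      have hev : v =ᶠ[𝓝 y] fun z ↦ χ k z * u z := by
        filter_upwards [hSo.mem_nhds hy] with z hz
        exact hvS z hz
      have hud : HasFDerivAt u (fderiv ℝ u y) y :=
        ((hu y (hSU y hy)).differentiableAt one_ne_zero).hasFDerivAt
      have hχd : HasFDerivAt (χ k) (fderiv ℝ (χ k) y) y :=
        ((hχC.differentiable one_ne_zero) y).hasFDerivAt
      have hprod : HasFDerivAt (fun z ↦ χ k z * u z)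
          (χ k y • fderiv ℝ u y + u y • fderiv ℝ (χ k) y) y := hχd.mul hud
      have hDv : fderiv ℝ v y = χ k y • fderiv ℝ u y + u y • fderiv ℝ (χ k) y := by
        rw [hev.fderiv_eq, hprod.fderiv]
      -- norms
      have ha : ‖χ k y • fderiv ℝ u y‖ ≤ ‖fderiv ℝ u y‖ := by
        rw [norm_smul, Real.norm_eq_abs, abs_of_nonneg (hχnn y)]
        exact mul_le_of_le_one_left (norm_nonneg _) (hχ1 y)
      have hb : ‖u y • fderiv ℝ (χ k) y‖ ^ 2 ≤
          4 * C₁ ^ 2 * {y : E | (k : ℝ) ≤ ‖y‖}.indicator (fun y ↦ u y ^ 2 / ‖y‖ ^ 2) y := by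
        by_cases hyk : (k : ℝ) ≤ ‖y‖
        · rw [indicator_of_mem (show y ∈ {y : E | (k : ℝ) ≤ ‖y‖} from hyk), norm_smul,
            Real.norm_eq_abs, mul_pow, sq_abs]
          have hD := hχD y hyk
          have h1 : ‖fderiv ℝ (χ k) y‖ ^ 2 ≤ (2 * C₁ / ‖y‖) ^ 2 :=
            pow_le_pow_left₀ (norm_nonneg _) hD 2
          calc u y ^ 2 * ‖fderiv ℝ (χ k) y‖ ^ 2 ≤ u y ^ 2 * (2 * C₁ / ‖y‖) ^ 2 :=
                mul_le_mul_of_nonneg_left h1 (sq_nonneg _)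
            _ = 4 * C₁ ^ 2 * (u y ^ 2 / ‖y‖ ^ 2) := by
                field_simp
                ring
        · rw [indicator_of_notMem (show y ∉ {y : E | (k : ℝ) ≤ ‖y‖} from hyk),
            hχD0 y (not_le.mp hyk), smul_zero, norm_zero]
          simp
      have hsq : ‖fderiv ℝ v y‖ ^ 2 ≤ (1 + ε) * ‖fderiv ℝ u y‖ ^ 2 +
          (1 + ε⁻¹) * (4 * C₁ ^ 2 *
            {y : E | (k : ℝ) ≤ ‖y‖}.indicator (fun y ↦ u y ^ 2 / ‖y‖ ^ 2) y) := by
        have htri : ‖fderiv ℝ v y‖ ≤ ‖χ k y • fderiv ℝ u y‖ + ‖u y • fderiv ℝ (χ k) y‖ := by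
          rw [hDv]; exact norm_add_le _ _
        have hεinv : 0 ≤ 1 + ε⁻¹ := by positivity
        calc ‖fderiv ℝ v y‖ ^ 2 ≤ (‖χ k y • fderiv ℝ u y‖ + ‖u y • fderiv ℝ (χ k) y‖) ^ 2 :=
              pow_le_pow_left₀ (norm_nonneg _) htri 2
          _ ≤ (1 + ε) * ‖χ k y • fderiv ℝ u y‖ ^ 2 + (1 + ε⁻¹) * ‖u y • fderiv ℝ (χ k) y‖ ^ 2 :=
              add_sq_le_eps _ _ hε
          _ ≤ (1 + ε) * ‖fderiv ℝ u y‖ ^ 2 + (1 + ε⁻¹) * (4 * C₁ ^ 2 *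
                {y : E | (k : ℝ) ≤ ‖y‖}.indicator (fun y ↦ u y ^ 2 / ‖y‖ ^ 2) y) :=
              add_le_add (mul_le_mul_of_nonneg_left (pow_le_pow_left₀ (norm_nonneg _) ha 2)
                (by positivity)) (mul_le_mul_of_nonneg_left hb hεinv)
      -- to `ℝ≥0∞`
      have hind : ENNReal.ofReal ({y : E | (k : ℝ) ≤ ‖y‖}.indicator
          (fun y ↦ u y ^ 2 / ‖y‖ ^ 2) y) = {y : E | (k : ℝ) ≤ ‖y‖}.indicator F y := by
        by_cases hyk : y ∈ {y : E | (k : ℝ) ≤ ‖y‖}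
        · rw [indicator_of_mem hyk, indicator_of_mem hyk]
        · rw [indicator_of_notMem hyk, indicator_of_notMem hyk, ENNReal.ofReal_zero]
      calc ENNReal.ofReal (‖fderiv ℝ v y‖ ^ 2)
          ≤ ENNReal.ofReal ((1 + ε) * ‖fderiv ℝ u y‖ ^ 2 + (1 + ε⁻¹) * (4 * C₁ ^ 2 *
              {y : E | (k : ℝ) ≤ ‖y‖}.indicator (fun y ↦ u y ^ 2 / ‖y‖ ^ 2) y)) :=
            ENNReal.ofReal_le_ofReal hsq
        _ = ENNReal.ofReal (1 + ε) * G y + ENNReal.ofReal ((1 + ε⁻¹) * (4 * C₁ ^ 2)) *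
              {y : E | (k : ℝ) ≤ ‖y‖}.indicator F y := by
            have h1 : 0 ≤ (1 + ε) * ‖fderiv ℝ u y‖ ^ 2 := by positivity
            have h2 : 0 ≤ {y : E | (k : ℝ) ≤ ‖y‖}.indicator (fun y ↦ u y ^ 2 / ‖y‖ ^ 2) y :=
              indicator_nonneg (fun z _ ↦ by positivity) _
            have h3 : 0 ≤ (1 + ε⁻¹) * (4 * C₁ ^ 2) := by positivity
            rw [ENNReal.ofReal_add h1 (by positivity), ENNReal.ofReal_mul (by positivity),
              ← mul_assoc, ENNReal.ofReal_mul h3, hind]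
    -- integrate the pointwise bound over `S`
    have hmeas_k : MeasurableSet {y : E | (k : ℝ) ≤ ‖y‖} :=
      (isClosed_le continuous_const continuous_norm).measurableSet
    have hint_bound : (∫⁻ y in S, ENNReal.ofReal (‖fderiv ℝ v y‖ ^ 2)) ≤
        ENNReal.ofReal (1 + ε) * D + ENNReal.ofReal ((1 + ε⁻¹) * (4 * C₁ ^ 2)) * t k := by
      calc (∫⁻ y in S, ENNReal.ofReal (‖fderiv ℝ v y‖ ^ 2))
          ≤ ∫⁻ y in S, (ENNReal.ofReal (1 + ε) * G y + ENNReal.ofReal ((1 + ε⁻¹) * (4 * C₁ ^ 2)) *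
              {y : E | (k : ℝ) ≤ ‖y‖}.indicator F y) := setLIntegral_mono' hSm hpt
        _ = ENNReal.ofReal (1 + ε) * D + ENNReal.ofReal ((1 + ε⁻¹) * (4 * C₁ ^ 2)) *
              ∫⁻ y in S, {y : E | (k : ℝ) ≤ ‖y‖}.indicator F y := by
            rw [lintegral_add_left' (hGm.const_mul _), lintegral_const_mul' _ _
              ENNReal.ofReal_ne_top, lintegral_const_mul' _ _ ENNReal.ofReal_ne_top]
        _ = ENNReal.ofReal (1 + ε) * D + ENNReal.ofReal ((1 + ε⁻¹) * (4 * C₁ ^ 2)) * t k := by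
            rw [lintegral_indicator hmeas_k, Measure.restrict_restrict hmeas_k, htdef,
              inter_comm]
    -- the left side dominates the truncation `m k`
    have hlow : m k ≤ ∫⁻ y in S, ENNReal.ofReal (v y ^ 2 / ‖y‖ ^ 2) := by
      have heq : ∀ y ∈ S ∩ closedBall (0 : E) k,
          F y = ENNReal.ofReal (v y ^ 2 / ‖y‖ ^ 2) := by
        intro y hy
        rw [hFdef, hvS y hy.1, hχone y (mem_closedBall_zero_iff.mp hy.2), one_mul]
      calc m k = ∫⁻ y in S ∩ closedBall (0 : E) k, ENNReal.ofReal (v y ^ 2 / ‖y‖ ^ 2) :=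
            setLIntegral_congr_fun (hSm.inter measurableSet_closedBall) heq
        _ ≤ ∫⁻ y in S, ENNReal.ofReal (v y ^ 2 / ‖y‖ ^ 2) := lintegral_mono_set inter_subset_left
    -- assemble
    calc m k ≤ ∫⁻ y in S, ENNReal.ofReal (v y ^ 2 / ‖y‖ ^ 2) := hlow
      _ ≤ ENNReal.ofReal c * ∫⁻ y in S, ENNReal.ofReal (‖fderiv ℝ v y‖ ^ 2) := hH'
      _ ≤ ENNReal.ofReal c * (ENNReal.ofReal (1 + ε) * D +
            ENNReal.ofReal ((1 + ε⁻¹) * (4 * C₁ ^ 2)) * t k) := mul_le_mul' le_rfl hint_bound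
      _ = ENNReal.ofReal (c * (1 + ε)) * D +
            ENNReal.ofReal (c * (1 + ε⁻¹) * (4 * C₁ ^ 2)) * t k := by
          rw [mul_add, ← mul_assoc, ← mul_assoc, ← ENNReal.ofReal_mul hcpos.le,
            ← ENNReal.ofReal_mul hcpos.le, ← mul_assoc]
  -- the limit `k → ∞` for fixed `ε`
  have hε_bound : ∀ ε : ℝ, 0 < ε → I ≤ ENNReal.ofReal (c * (1 + ε)) * D := by
    intro ε hε
    set K' : ℝ≥0∞ := ENNReal.ofReal (c * (1 + ε⁻¹) * (4 * C₁ ^ 2)) with hK'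
    have hK'top : K' ≠ ⊤ := ENNReal.ofReal_ne_top
    have hstep : ∀ k : ℕ, m (k + 1) + K' * m k ≤ ENNReal.ofReal (c * (1 + ε)) * D + K' * I := by
      intro k
      have h1 := hA (k + 1) (Nat.le_add_left 1 k) ε hε
      have h2 := hB (k + 1) (Nat.le_add_left 1 k)
      rw [Nat.add_sub_cancel] at h2
      calc m (k + 1) + K' * m k
          ≤ (ENNReal.ofReal (c * (1 + ε)) * D + K' * t (k + 1)) + K' * m k :=
            add_le_add h1 le_rfl
        _ = ENNReal.ofReal (c * (1 + ε)) * D + K' * (t (k + 1) + m k) := by ring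
        _ ≤ ENNReal.ofReal (c * (1 + ε)) * D + K' * I :=
            add_le_add le_rfl (mul_le_mul' le_rfl h2)
    have hlim : Tendsto (fun k : ℕ ↦ m (k + 1) + K' * m k) atTop (𝓝 (I + K' * I)) :=
      (hCm.comp (tendsto_add_atTop_nat 1)).add (ENNReal.Tendsto.const_mul hCm (Or.inr hK'top))
    have hle : I + K' * I ≤ ENNReal.ofReal (c * (1 + ε)) * D + K' * I :=
      le_of_tendsto' hlim hstep
    have hKI : K' * I ≠ ⊤ := ENNReal.mul_ne_top hK'top hItop
    exact (ENNReal.add_le_add_iff_right hKI).mp hle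
  -- the limit `ε → 0`
  have hlimε : Tendsto (fun j : ℕ ↦ ENNReal.ofReal (c * (1 + 1 / ((j : ℝ) + 1))) * D) atTop
      (𝓝 (ENNReal.ofReal c * D)) := by
    have h1 : Tendsto (fun j : ℕ ↦ c * (1 + 1 / ((j : ℝ) + 1))) atTop (𝓝 (c * (1 + 0))) :=
      tendsto_const_nhds.mul (tendsto_const_nhds.add tendsto_one_div_add_atTop_nhds_zero_nat)
    rw [add_zero, mul_one] at h1
    have h2 : Tendsto (fun j : ℕ ↦ ENNReal.ofReal (c * (1 + 1 / ((j : ℝ) + 1)))) atTop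
        (𝓝 (ENNReal.ofReal c)) := (ENNReal.continuous_ofReal.tendsto c).comp h1
    exact ENNReal.Tendsto.mul_const h2 (Or.inl (ENNReal.ofReal_pos.mpr hcpos).ne')
  exact ge_of_tendsto' hlimε fun j ↦ hε_bound _ (by positivity)

/-! ### Dimension three: integrability from the decay `‖y‖ |u| ≤ C₀` -/

/-- In dimension `3`, `∫_{‖y‖ > R} ‖y‖⁻⁴ dy < ∞` (`R > 0`), via the integrability of
`(1 + ‖y‖)^{-4}` (Mathlib's `finite_integral_one_add_norm`). [folklore] -/
theorem lintegral_norm_inv_pow_four_exterior_lt_top (hE : finrank ℝ E = 3) {R : ℝ} (hR : 0 < R) :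
    ∫⁻ y in {y : E | R < ‖y‖}, ENNReal.ofReal (‖y‖⁻¹ ^ 4) < ⊤ := by
  have h4 : (finrank ℝ E : ℝ) < 4 := by rw [hE]; norm_num
  have hfin := finite_integral_one_add_norm (E := E) (μ := volume) h4
  -- on `{‖y‖ > R}`: `‖y‖⁻⁴ ≤ ((1 + R)/R)⁴ (1 + ‖y‖)⁻⁴`
  set A : ℝ := ((1 + R) / R) ^ 4 with hA
  have hpt : ∀ y ∈ {y : E | R < ‖y‖},
      ENNReal.ofReal (‖y‖⁻¹ ^ 4) ≤ ENNReal.ofReal A * ENNReal.ofReal ((1 + ‖y‖) ^ (-(4 : ℝ))) := by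
    intro y hy
    have hyR : R < ‖y‖ := hy
    have hypos : 0 < ‖y‖ := hR.trans hyR
    rw [← ENNReal.ofReal_mul (by positivity)]
    refine ENNReal.ofReal_le_ofReal ?_
    rw [Real.rpow_neg (by positivity), show (4 : ℝ) = ((4 : ℕ) : ℝ) by norm_num,
      Real.rpow_natCast, hA, ← inv_pow, ← mul_pow]
    refine pow_le_pow_left₀ (inv_nonneg.mpr (norm_nonneg _)) ?_ 4
    rw [inv_le_iff_one_le_mul₀ hypos]
    have h1 : 1 ≤ (1 + R) / R * ‖y‖ / (1 + ‖y‖) := by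
      rw [le_div_iff₀ (by positivity), div_mul_eq_mul_div, le_div_iff₀ hR]
      nlinarith
    calc (1 : ℝ) ≤ (1 + R) / R * ‖y‖ / (1 + ‖y‖) := h1
      _ = (1 + R) / R * (1 + ‖y‖)⁻¹ * ‖y‖ := by ring
  calc ∫⁻ y in {y : E | R < ‖y‖}, ENNReal.ofReal (‖y‖⁻¹ ^ 4)
      ≤ ∫⁻ y in {y : E | R < ‖y‖}, ENNReal.ofReal A * ENNReal.ofReal ((1 + ‖y‖) ^ (-(4 : ℝ))) :=
        setLIntegral_mono' (isOpen_lt continuous_const continuous_norm).measurableSet hpt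
    _ = ENNReal.ofReal A * ∫⁻ y in {y : E | R < ‖y‖}, ENNReal.ofReal ((1 + ‖y‖) ^ (-(4 : ℝ))) :=
        lintegral_const_mul' _ _ ENNReal.ofReal_ne_top
    _ ≤ ENNReal.ofReal A * ∫⁻ y, ENNReal.ofReal ((1 + ‖y‖) ^ (-(4 : ℝ))) :=
        mul_le_mul' le_rfl (setLIntegral_le_lintegral _ _)
    _ < ⊤ := ENNReal.mul_lt_top ENNReal.ofReal_lt_top hfin

/-- **Integrability of `u²/‖y‖²` outside a ball from the decay `‖y‖ |u(y)| ≤ C₀`**, dimension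
`3`: `u²/‖y‖² ≤ C₀² ‖y‖⁻⁴`. [folklore] -/
theorem lintegral_sq_div_norm_sq_lt_top_of_decay (hE : finrank ℝ E = 3) {u : E → ℝ} {R C₀ : ℝ}
    (hR : 0 < R) (hdec : ∀ y : E, R < ‖y‖ → ‖y‖ * |u y| ≤ C₀) :
    ∫⁻ y in {y : E | R < ‖y‖}, ENNReal.ofReal (u y ^ 2 / ‖y‖ ^ 2) < ⊤ := by
  have hpt : ∀ y ∈ {y : E | R < ‖y‖},
      ENNReal.ofReal (u y ^ 2 / ‖y‖ ^ 2) ≤ ENNReal.ofReal (C₀ ^ 2) * ENNReal.ofReal (‖y‖⁻¹ ^ 4) := by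
    intro y hy
    have hyR : R < ‖y‖ := hy
    have hypos : 0 < ‖y‖ := hR.trans hyR
    rw [← ENNReal.ofReal_mul (sq_nonneg _)]
    refine ENNReal.ofReal_le_ofReal ?_
    have h1 : (‖y‖ * |u y|) ^ 2 ≤ C₀ ^ 2 :=
      pow_le_pow_left₀ (by positivity) (hdec y hyR) 2
    rw [mul_pow, sq_abs] at h1
    rw [div_le_iff₀ (by positivity)]
    calc u y ^ 2 = (‖y‖ ^ 2 * u y ^ 2) * (‖y‖⁻¹ ^ 4 * ‖y‖ ^ 2) := by field_simp
      _ ≤ C₀ ^ 2 * (‖y‖⁻¹ ^ 4 * ‖y‖ ^ 2) := mul_le_mul_of_nonneg_right h1 (by positivity)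
      _ = C₀ ^ 2 * ‖y‖⁻¹ ^ 4 * ‖y‖ ^ 2 := by ring
  calc ∫⁻ y in {y : E | R < ‖y‖}, ENNReal.ofReal (u y ^ 2 / ‖y‖ ^ 2)
      ≤ ∫⁻ y in {y : E | R < ‖y‖}, ENNReal.ofReal (C₀ ^ 2) * ENNReal.ofReal (‖y‖⁻¹ ^ 4) :=
        setLIntegral_mono' (isOpen_lt continuous_const continuous_norm).measurableSet hpt
    _ = ENNReal.ofReal (C₀ ^ 2) * ∫⁻ y in {y : E | R < ‖y‖}, ENNReal.ofReal (‖y‖⁻¹ ^ 4) :=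
        lintegral_const_mul' _ _ ENNReal.ofReal_ne_top
    _ < ⊤ := ENNReal.mul_lt_top ENNReal.ofReal_lt_top
        (lintegral_norm_inv_pow_four_exterior_lt_top hE hR)

/-- **Hardy's inequality outside a ball from smoothness near the exterior and the decay
`‖y‖ |u| ≤ C₀`**, dimension `3`, constant `4`: `∫_{‖y‖ > R} u²/‖y‖² ≤ 4 ∫_{‖y‖ > R} ‖Du‖²`
(Dafermos–Rodnianski–Shlapentokh-Rothman, arXiv:1402.7034, §4.3, on asymptotically hyperboloidal
leaves; Moschidis, arXiv:1509.08489, Lemma 12.3). [cite: DafermosRodnianskiShlapentokhrothman2014, §4.3] -/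
theorem hardy_sq_lintegral_exterior_le_of_decay (hE : finrank ℝ E = 3) {u : E → ℝ} {R₀ R C₀ : ℝ}
    (hR₀ : R₀ < R) (hR : 0 < R) (hu : ∀ y : E, R₀ < ‖y‖ → ContDiffAt ℝ 1 u y)
    (hdec : ∀ y : E, R < ‖y‖ → ‖y‖ * |u y| ≤ C₀) :
    ∫⁻ y in {y : E | R < ‖y‖}, ENNReal.ofReal (u y ^ 2 / ‖y‖ ^ 2) ≤
      4 * ∫⁻ y in {y : E | R < ‖y‖}, ENNReal.ofReal (‖fderiv ℝ u y‖ ^ 2) := by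
  have hn : 3 ≤ finrank ℝ E := hE.ge
  have h := hardy_sq_lintegral_exterior_le_of_integrable hR₀ hR hu
    (lintegral_sq_div_norm_sq_lt_top_of_decay hE hR hdec) hn
  have hc : ENNReal.ofReal ((2 / ((finrank ℝ E : ℝ) - 2)) ^ 2) = 4 := by
    rw [hE]; norm_num
  rwa [hc] at h

end Literature.Analysis.Calculus

end
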